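import Mathlib
import HarnessLib
import Summits.NavierStokesRegularity.NavierStokesRegularity.Theorems.HalfSpaceWindowDoorCirculationCarryingRigidityGaussInflowLaw
import Summits.NavierStokesRegularity.NavierStokesRegularity.Theorems.HalfSpaceWindowDoorCirculationCarryingRigidityGaussExtremalFamily

/-!
# Route `HalfSpaceWindowDoor`, crux `CirculationCarryingRigidity` (stmt-NavierStokesRegularity-25311) —
# the SECOND-ORDER CONDITION at the Gaussian-extremal point: `dℐ/dσ ≥ 0` along the extremal characteristic

LEAD ns-hsw-p1 g8 (cell pub-ns-dss), `--supports stmt-NavierStokesRegularity-25311 --as helper`; sequel of `…GaussInflowLaw` (the kinematic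
inflow law `dℐ/ds` on the door class) and of `…GaussExtremalFamily` (the normal form: `Λ = 𝒢(1;0)[W(−1)]` maximal over all times, scales
`≤ −σ` and axes, with the maximal-inflow identity `ℐ(1;0)[W(−1)] = −2Λ`).  Along the extremal characteristic (apex `0`, axis `0`) put
`f(σ) = 𝒢(−σ;0)[W(σ)]`, `J(σ) = ℐ(−σ;0)[W(σ)]`; the swirl law O1 reads `f' = −(f + J/2)/(−σ)`, so `f'(−1) = 0` is (E3), and since `f ≤ f(−1)`
on `(−∞,0)` the function `h = f + J/2` (which vanishes at `−1`) cannot have NEGATIVE derivative at `−1` (else `f' = −h/(−σ) > 0` just after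
`−1` and `f` would exceed its maximum, by the mean value theorem).  Hence

* `deriv_nonneg_of_max_of_swirl` — the real-variable lemma: `f ≤ f(−1)`, `f' = −(f + J/2)/(−σ)` on `(−∞,0)`, `f(−1) + J(−1)/2 = 0`,
  `J` differentiable at `−1` ⇒ `J'(−1) ≥ 0`;
* `gaussExtremal_secondOrder` — **THE SECOND-ORDER CONDITION**: if W6 fails at constant `C`, there is a closed-hemisphere door-class `W`
  (constant `C`) with `Λ = 𝒢(1;0)[W(−1)] > 0` maximal over the whole characteristic family, `ℐ(1;0)[W(−1)] = −2Λ`, AND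
  **`0 ≤ dℐ(−σ;0)[W(σ)]/dσ |_{σ=−1} = (4π)^{3/2}∫[−(‖x‖²/4 − 3/2)G₁·⟪x,u⟫g + G₁·(⟪x,u̇⟫g + ⟪x,u⟫(x₀u̇₁ − x₁u̇₀))] dx`**, `u = W(−1)`,
  `u̇ = ∂ₜW(−1) = Δu − (u·∇)u − ∇p` (classical pressure of the class), `g = x₀u₁ − x₁u₀` — the inflow correlation is becoming LESS negative
  at the extremal time: «the collapse decelerates»;
* `hemisphereLiouvilleE3_of_secondOrder`, `circulationCarryingRigidity_of_secondOrder` — the corresponding reductions.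

This completes the typed extremal system to second order in the characteristic variable (first order: `…GaussExtremalConditions`,
`…Moments`, `…Hessian`, `…Centering`, `…Tilting(Sharp)`, `…Stretching`).  WHAT THIS IS NOT: not a statement about Navier–Stokes
regularity; door statements concern HYPOTHETICAL blow-up profiles (KNSS ancient mild solutions).  No item is closed by this file.
-/

noncomputable section

-- the summit and its single sub-problem share the name (CONVENTIONS §1), as in every Theorems file
set_option linter.dupNamespace false

namespace Summit.NavierStokesRegularity.NavierStokesRegularity.Theorems.HalfSpaceWindowDoorCirculationCarryingRigidityGaussExtremalSecondOrder

open scoped BigOperators Topology MeasureTheory InnerProductSpace RealInnerProductSpace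
open Filter Set Function MeasureTheory Metric
open Literature.Analysis Literature.Analysis.FluidPDE Literature.Analysis.UnboundedOperators
open Summit.NavierStokesRegularity.NavierStokesRegularity.Theses.HalfSpaceWindowDoor
open Summit.NavierStokesRegularity.NavierStokesRegularity.Theorems.HalfSpaceWindowDoorCirculationCarryingRigidityDefs
open Summit.NavierStokesRegularity.NavierStokesRegularity.Theorems.HalfSpaceWindowDoorCirculationCarryingRigidityReduction
  (circulationCarryingRigidity_of_hemisphereLiouvilleE3)
open Summit.NavierStokesRegularity.NavierStokesRegularity.Theorems.HalfSpaceWindowDoorCirculationCarryingRigidityGaussSwirlLaw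
  (gaussianSwirlLaw_holds)
open Summit.NavierStokesRegularity.NavierStokesRegularity.Theorems.HalfSpaceWindowDoorCirculationCarryingRigidityGaussExtremalFamily
  (exists_gaussExtremal')
open Summit.NavierStokesRegularity.NavierStokesRegularity.Theorems.HalfSpaceWindowDoorCirculationCarryingRigidityGaussInflowLaw
  (hasDerivAt_gaussInflow_of_class)
open Summit.NavierStokesRegularity.NavierStokesRegularity.Theorems.ChiralWindowDoorClassDerivDecay (exists_classical_of_class)
open scoped Laplacian

/-! ### The real-variable lemma -/

/-- **Second-order test along the characteristic.**  Let `f, J : ℝ → ℝ` with `f σ ≤ f(−1)` for all `σ < 0`,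
`f' σ = −(f σ + J σ/2)/(−σ)` (as a derivative) at every `σ < 0`, `f(−1) + J(−1)/2 = 0`, and `J` differentiable at `−1` with derivative
`D`.  Then `0 ≤ D`. -/
theorem deriv_nonneg_of_max_of_swirl {f J : ℝ → ℝ} {D : ℝ} (hmax : ∀ σ < 0, f σ ≤ f (-1))
    (hf : ∀ σ < 0, HasDerivAt f (-(f σ + J σ / 2) / (-σ)) σ) (h0 : f (-1) + J (-1) / 2 = 0) (hJ : HasDerivAt J D (-1)) :
    0 ≤ D := by
  by_contra hD
  rw [not_le] at hD
  -- `h = f + J/2` vanishes at `−1` with negative derivative `D/2`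
  set h : ℝ → ℝ := fun σ => f σ + J σ / 2 with hh
  have hf1 : HasDerivAt f (-(f (-1) + J (-1) / 2) / (-(-1 : ℝ))) (-1) := hf (-1) (by norm_num)
  rw [h0] at hf1
  norm_num at hf1
  have hh' : HasDerivAt h (0 + D / 2) (-1) := hf1.add (hJ.div_const 2)
  have hhd : deriv h (-1) < 0 := by rw [hh'.deriv]; linarith
  have hh0 : h (-1) = 0 := h0
  have hsign := eventually_nhdsWithin_sign_eq_of_deriv_neg hhd hh0
  obtain ⟨ε, hε, hball⟩ := Metric.eventually_nhds_iff.1 hsign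
  -- a point `σ₁ ∈ (−1, 0)` within `ε` of `−1`
  set σ₁ : ℝ := -1 + min (ε / 2) (1 / 2) with hσ₁
  have hmin_pos : 0 < min (ε / 2) (1 / 2) := lt_min (by linarith) (by norm_num)
  have hσ₁gt : -1 < σ₁ := by rw [hσ₁]; linarith
  have hσ₁lt : σ₁ < 0 := by
    have : min (ε / 2) (1 / 2) ≤ 1 / 2 := min_le_right _ _
    rw [hσ₁]; linarith
  have hneg_h : ∀ ξ ∈ Ioo (-1 : ℝ) σ₁, h ξ < 0 := by
    intro ξ hξ
    have hdist : dist ξ (-1) < ε := by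
      rw [Real.dist_eq]
      have : min (ε / 2) (1 / 2) ≤ ε / 2 := min_le_left _ _
      rw [abs_of_pos (by linarith [hξ.1])]
      linarith [hξ.2]
    have hs := hball hdist
    have hlt : -1 - ξ < 0 := by linarith [hξ.1]
    rw [sign_neg hlt, sign_eq_neg_one_iff] at hs
    exact hs
  -- mean value theorem on `[−1, σ₁]`
  have hcont : ContinuousOn f (Icc (-1) σ₁) := fun σ hσ =>
    (hf σ (lt_of_le_of_lt hσ.2 hσ₁lt)).continuousAt.continuousWithinAt
  have hder : ∀ σ ∈ Ioo (-1) σ₁, HasDerivAt f (-(f σ + J σ / 2) / (-σ)) σ := fun σ hσ => hf σ (lt_trans hσ.2 hσ₁lt)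
  obtain ⟨ξ, hξ, hslope⟩ := exists_hasDerivAt_eq_slope f (fun σ => -(f σ + J σ / 2) / (-σ)) hσ₁gt hcont hder
  have hξ0 : 0 < -ξ := by linarith [hξ.2]
  have hpos : 0 < -(f ξ + J ξ / 2) / (-ξ) := by
    have hhξ : f ξ + J ξ / 2 < 0 := hneg_h ξ hξ
    exact div_pos (by linarith) hξ0
  rw [hslope] at hpos
  have hnum : 0 < f σ₁ - f (-1) := by
    have hden : 0 < σ₁ - -1 := by linarith
    exact (div_pos_iff_of_pos_right hden).1 hpos
  linarith [hmax σ₁ hσ₁lt]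

variable {C : ℝ}

/-! ### The velocity rate on the class is Navier–Stokes with a classical pressure -/

/-- On the door class, `∂ₜv = Δv − (v·∇)v − ∇p` pointwise on the open slab for some classical pressure `p` (the class is classical:
`exists_classical_of_class`; the time derivative within the open slab is the plain derivative). -/
theorem exists_pressure_deriv_eq_of_class {v : ℝ → EuclideanSpace ℝ (Fin 3) → EuclideanSpace ℝ (Fin 3)} (hv : InDoorClass C v) :
    ∃ p : ℝ → EuclideanSpace ℝ (Fin 3) → ℝ, IsClassicalNSSolutionOn (Iio (0 : ℝ)) 1 0 v p ∧
      ∀ s < (0 : ℝ), ∀ x, deriv (fun τ => v τ x) s = (Δ (v s)) x - convect (v s) (v s) x - gradient (p s) x := by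
  obtain ⟨hrate, hcont, hmild, hdiv⟩ := hv
  obtain ⟨p, hcl⟩ := exists_classical_of_class hrate hcont hmild hdiv
  refine ⟨p, hcl, fun s hs x => ?_⟩
  have hmom := hcl.momentum s hs x
  simp only [one_smul, Pi.zero_apply, add_zero] at hmom
  have htd : timeDerivWithin (Iio (0 : ℝ)) v s x = deriv (fun τ => v τ x) s := by
    rw [timeDerivWithin, derivWithin_of_isOpen isOpen_Iio hs]
  rw [htd] at hmom
  have h := eq_sub_of_add_eq hmom
  rw [h]
  abel

/-! ### The second-order condition at the Gaussian-extremal point -/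

/-- **THE SECOND-ORDER CONDITION AT THE GAUSSIAN-EXTREMAL POINT.**  If some closed-hemisphere door-class profile (Type-I constant `C`) has
`⟪curl v(s₁)(y₁), e₃⟫ > 0` somewhere, there is a closed-hemisphere door-class `W` (constant `C`) with: `Λ = 𝒢(1;0)[W(−1)] > 0` maximal
against every time `σ < 0`, every scale `0 < t ≤ −σ` and every axis; the maximal-inflow identity `ℐ(1;0)[W(−1)] = −2Λ`; and the
SECOND-ORDER condition `0 ≤ dℐ(−σ;0)[W(σ)]/dσ|_{σ=−1}`, written out with `u = W(−1)`, `u̇(x) = ∂ₜW(−1,x) = deriv (W · x) (−1)`,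
`g = angMom 0 u`; together with a classical pressure `p` for which `u̇ = Δu − (u·∇)u − ∇p(−1)` (and the same at every `s < 0`). -/
theorem gaussExtremal_secondOrder {v : ℝ → EuclideanSpace ℝ (Fin 3) → EuclideanSpace ℝ (Fin 3)} (hv : InDoorClass C v)
    (hsign : SignE3 v) (hpos : ∃ s < 0, ∃ y, 0 < ⟪curl (v s) y, e3⟫) :
    ∃ W : ℝ → EuclideanSpace ℝ (Fin 3) → EuclideanSpace ℝ (Fin 3), InDoorClass C W ∧ SignE3 W ∧
      0 < gaussAngMom 1 0 (W (-1)) ∧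
      (∀ σ < 0, ∀ t : ℝ, 0 < t → t ≤ -σ → ∀ y₀, gaussAngMom t y₀ (W σ) ≤ gaussAngMom 1 0 (W (-1))) ∧
      gaussInflow 1 0 (W (-1)) = -2 * gaussAngMom 1 0 (W (-1)) ∧
      (∃ p : ℝ → EuclideanSpace ℝ (Fin 3) → ℝ, IsClassicalNSSolutionOn (Iio (0 : ℝ)) 1 0 W p ∧
        ∀ s < (0 : ℝ), ∀ x, deriv (fun τ => W τ x) s = (Δ (W s)) x - convect (W s) (W s) x - gradient (p s) x) ∧
      HasDerivAt (fun σ => gaussInflow (0 - σ) 0 (W σ))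
        ((4 * Real.pi) ^ ((3 : ℝ) / 2) *
          ∫ x, (-((‖x - 0‖ ^ 2 / (4 * (0 - (-1 : ℝ)) ^ 2) - (3 : ℝ) / (2 * (0 - (-1 : ℝ)))) * heatKernel (0 - (-1 : ℝ)) (x - 0)) *
              (⟪x - 0, W (-1) x⟫ * angMom 0 (W (-1)) x) +
            heatKernel (0 - (-1 : ℝ)) (x - 0) *
              (⟪x - 0, deriv (fun τ => W τ x) (-1)⟫ * angMom 0 (W (-1)) x +
                ⟪x - 0, W (-1) x⟫ * ((x - 0) 0 * deriv (fun τ => W τ x) (-1) 1 - (x - 0) 1 * deriv (fun τ => W τ x) (-1) 0)))) (-1) ∧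
      0 ≤ (4 * Real.pi) ^ ((3 : ℝ) / 2) *
          ∫ x, (-((‖x - 0‖ ^ 2 / (4 * (0 - (-1 : ℝ)) ^ 2) - (3 : ℝ) / (2 * (0 - (-1 : ℝ)))) * heatKernel (0 - (-1 : ℝ)) (x - 0)) *
              (⟪x - 0, W (-1) x⟫ * angMom 0 (W (-1)) x) +
            heatKernel (0 - (-1 : ℝ)) (x - 0) *
              (⟪x - 0, deriv (fun τ => W τ x) (-1)⟫ * angMom 0 (W (-1)) x +
                ⟪x - 0, W (-1) x⟫ * ((x - 0) 0 * deriv (fun τ => W τ x) (-1) 1 - (x - 0) 1 * deriv (fun τ => W τ x) (-1) 0))) := by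
  obtain ⟨W, hW, hWs, hΛ, hmax, hI⟩ := exists_gaussExtremal' hv hsign hpos
  have hm1 : (-1 : ℝ) < 0 := by norm_num
  -- the inflow law at `(s₀, s) = (0, −1)`
  have hJ := hasDerivAt_gaussInflow_of_class hW 0 hm1 hm1
  refine ⟨W, hW, hWs, hΛ, hmax, hI, exists_pressure_deriv_eq_of_class hW, hJ, ?_⟩
  -- the swirl law along the apex-0 characteristic and the second-order test
  set f : ℝ → ℝ := fun σ => gaussAngMom (0 - σ) 0 (W σ) with hf
  set J : ℝ → ℝ := fun σ => gaussInflow (0 - σ) 0 (W σ) with hJdef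
  have hswirl : ∀ σ < 0, HasDerivAt f (-(f σ + J σ / 2) / (-σ)) σ := by
    intro σ hσ
    have h := gaussianSwirlLaw_holds C W hW 0 0 σ hσ hσ
    simp only [hf, hJdef]
    refine h.congr_deriv ?_
    have hσ0 : σ ≠ 0 := hσ.ne
    have hσ0' : -σ ≠ 0 := neg_ne_zero.2 hσ0
    rw [zero_sub]
    field_simp
    ring
  have hfmax : ∀ σ < 0, f σ ≤ f (-1) := by
    intro σ hσ
    have h := hmax σ hσ (-σ) (neg_pos.2 hσ) le_rfl 0
    simp only [hf]
    rw [zero_sub, zero_sub, neg_neg]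
    exact h
  have h0 : f (-1) + J (-1) / 2 = 0 := by
    simp only [hf, hJdef]
    rw [zero_sub, neg_neg, hI]
    ring
  exact deriv_nonneg_of_max_of_swirl hfmax hswirl h0 hJ


/-! ### Reductions of W6 and of the crux -/

/-- **REDUCTION: W6 from the second-order system.**  If no closed-hemisphere door-class profile is Gaussian-extremal at `(1, −1, 0)` (maximal
`Λ > 0` over the whole characteristic family, `ℐ = −2Λ`) with the second-order condition `0 ≤ dℐ/dσ|_{σ=−1}` (explicit integral), then
`HemisphereLiouvilleE3` holds. -/
theorem hemisphereLiouvilleE3_of_secondOrder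
    (h : ∀ (C : ℝ) (W : ℝ → EuclideanSpace ℝ (Fin 3) → EuclideanSpace ℝ (Fin 3)), InDoorClass C W → SignE3 W →
      0 < gaussAngMom 1 0 (W (-1)) →
      (∀ σ < 0, ∀ t : ℝ, 0 < t → t ≤ -σ → ∀ y₀, gaussAngMom t y₀ (W σ) ≤ gaussAngMom 1 0 (W (-1))) →
      gaussInflow 1 0 (W (-1)) = -2 * gaussAngMom 1 0 (W (-1)) →
      0 ≤ (4 * Real.pi) ^ ((3 : ℝ) / 2) *
          ∫ x, (-((‖x - 0‖ ^ 2 / (4 * (0 - (-1 : ℝ)) ^ 2) - (3 : ℝ) / (2 * (0 - (-1 : ℝ)))) * heatKernel (0 - (-1 : ℝ)) (x - 0)) *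
              (⟪x - 0, W (-1) x⟫ * angMom 0 (W (-1)) x) +
            heatKernel (0 - (-1 : ℝ)) (x - 0) *
              (⟪x - 0, deriv (fun τ => W τ x) (-1)⟫ * angMom 0 (W (-1)) x +
                ⟪x - 0, W (-1) x⟫ * ((x - 0) 0 * deriv (fun τ => W τ x) (-1) 1 - (x - 0) 1 * deriv (fun τ => W τ x) (-1) 0))) →
      False) :
    HemisphereLiouvilleE3 := by
  intro C v hrate hcont hmild hdiv hsign s hs y
  by_contra hne
  have hpos : 0 < ⟪curl (v s) y, e3⟫ := lt_of_le_of_ne (hsign s hs y) (Ne.symm hne)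
  obtain ⟨W, hW, hWs, h0, h1, h2, -, -, h3⟩ := gaussExtremal_secondOrder (C := C) ⟨hrate, hcont, hmild, hdiv⟩ hsign ⟨s, hs, y, hpos⟩
  exact h C W hW hWs h0 h1 h2 h3

/-- **The crux from the second-order system** (composition with the landed plumbing `stub_rotate`). -/
theorem circulationCarryingRigidity_of_secondOrder
    (h : ∀ (C : ℝ) (W : ℝ → EuclideanSpace ℝ (Fin 3) → EuclideanSpace ℝ (Fin 3)), InDoorClass C W → SignE3 W →
      0 < gaussAngMom 1 0 (W (-1)) →
      (∀ σ < 0, ∀ t : ℝ, 0 < t → t ≤ -σ → ∀ y₀, gaussAngMom t y₀ (W σ) ≤ gaussAngMom 1 0 (W (-1))) →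
      gaussInflow 1 0 (W (-1)) = -2 * gaussAngMom 1 0 (W (-1)) →
      0 ≤ (4 * Real.pi) ^ ((3 : ℝ) / 2) *
          ∫ x, (-((‖x - 0‖ ^ 2 / (4 * (0 - (-1 : ℝ)) ^ 2) - (3 : ℝ) / (2 * (0 - (-1 : ℝ)))) * heatKernel (0 - (-1 : ℝ)) (x - 0)) *
              (⟪x - 0, W (-1) x⟫ * angMom 0 (W (-1)) x) +
            heatKernel (0 - (-1 : ℝ)) (x - 0) *
              (⟪x - 0, deriv (fun τ => W τ x) (-1)⟫ * angMom 0 (W (-1)) x +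
                ⟪x - 0, W (-1) x⟫ * ((x - 0) 0 * deriv (fun τ => W τ x) (-1) 1 - (x - 0) 1 * deriv (fun τ => W τ x) (-1) 0))) →
      False) :
    CirculationCarryingRigidity :=
  circulationCarryingRigidity_of_hemisphereLiouvilleE3 (hemisphereLiouvilleE3_of_secondOrder h)

end Summit.NavierStokesRegularity.NavierStokesRegularity.Theorems.HalfSpaceWindowDoorCirculationCarryingRigidityGaussExtremalSecondOrder

end
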